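import Summits.HubbardSuperconductivity.HubbardSuperconductivity.Theorems.BirComplexStableXY.Negative.WitnessTable
import HarnessLib

/-!
# Route `BalabanIR`, crux `BirComplexStableXYR` (item `stmt-HubbardSuperconductivity-14845`),
# line `fat-gaussian-defect-calculus`: stub S2 `stub_fatGaussianDomination`

Helper (`--supports`) for the crux
`Summit.HubbardSuperconductivity.HubbardSuperconductivity.Theses.BalabanIR.BirComplexStableXYR`,
line `fat-gaussian-defect-calculus` (lead skeleton `Cruxes/BirComplexStableXYR/Lines/fat_gaussian_defect_calculus.lean`),
stub S2 `stub_fatGaussianDomination` (fat-Gaussian domination of the modulus weight by coercivity (C)).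

**Statement.** For a window table `c : Table r` whose local generating function `F = genF c` satisfies the
coercivity hypothesis (C) `c₀ ΣΣ (1 − cos(φ_w − φ_w')) ≤ Re F(φ)` with `c₀ ≥ 0`, and `K ≥ 0`, the modulus of
the window weight is dominated by a Gaussian in the principal values `pv(φ_w − φ_w') ∈ (−π, π]`
(`pv = toIocMod two_pi_pos (−π)`):

  `‖exp(−K F(φ))‖ ≤ exp(−(2 c₀ K / π²) ΣΣ pv(φ_w − φ_w')²)`.

**Proof.** `‖exp z‖ = exp (Re z)` (`Complex.norm_exp`) and `Re(K F) = K Re F`; (C) bounds `K Re F` below by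
`c₀ K ΣΣ (1 − cos(φ_w − φ_w'))`; `cos` is `2π`-periodic so `cos(φ_w − φ_w') = cos pv`, and Jordan's inequality
`1 − cos ψ = 2 sin²(ψ/2) ≥ 2ψ²/π²` on `|ψ| ≤ π` (`Real.mul_abs_le_abs_sin`) finishes, pair by pair. [folklore]

Everything used is in Mathlib; no definition and no named fact is introduced.
-/

noncomputable section

namespace Summit.HubbardSuperconductivity.HubbardSuperconductivity.Theorems.FatGaussian

open scoped BigOperators ComplexConjugate
open MeasureTheory Literature.Probability.LatticeModels Summit.HubbardSuperconductivity.BirComplexStableXYNegative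

/-- Jordan's inequality in cosine form: `2ψ²/π² ≤ 1 − cos ψ` for `|ψ| ≤ π`. [folklore] -/
theorem two_mul_sq_div_pi_sq_le_one_sub_cos {ψ : ℝ} (hψ : |ψ| ≤ Real.pi) :
    2 * ψ ^ 2 / Real.pi ^ 2 ≤ 1 - Real.cos ψ := by
  have hπ := Real.pi_pos
  have h1 : 1 - Real.cos ψ = 2 * Real.sin (ψ / 2) ^ 2 := by
    have h := Real.cos_two_mul (ψ / 2)
    rw [show 2 * (ψ / 2) = ψ by ring] at h
    nlinarith [Real.sin_sq_add_cos_sq (ψ / 2)]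
  have h2 : |ψ / 2| ≤ Real.pi / 2 := by
    rw [abs_div, abs_two]
    linarith
  have hj := Real.mul_abs_le_abs_sin h2
  have hj0 : 0 ≤ 2 / Real.pi * |ψ / 2| := by positivity
  have hj2 : (2 / Real.pi * |ψ / 2|) ^ 2 ≤ |Real.sin (ψ / 2)| ^ 2 := pow_le_pow_left₀ hj0 hj 2
  rw [sq_abs, mul_pow, sq_abs] at hj2
  have e : 2 * ψ ^ 2 / Real.pi ^ 2 = 2 * ((2 / Real.pi) ^ 2 * (ψ / 2) ^ 2) := by
    field_simp
  rw [h1, e]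
  linarith

/-- The principal value `toIocMod 2π (−π) x ∈ (−π, π]` has absolute value at most `π`. [folklore] -/
theorem abs_toIocMod_two_pi_le (x : ℝ) : |toIocMod Real.two_pi_pos (-Real.pi) x| ≤ Real.pi := by
  have h := toIocMod_mem_Ioc Real.two_pi_pos (-Real.pi) x
  rw [Set.mem_Ioc] at h
  exact abs_le.2 ⟨h.1.le, by linarith [h.2]⟩

/-- `cos` only sees the principal value: `cos (toIocMod 2π (−π) x) = cos x`. [folklore] -/
theorem cos_toIocMod_two_pi (x : ℝ) : Real.cos (toIocMod Real.two_pi_pos (-Real.pi) x) = Real.cos x := by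
  rw [toIocMod]
  exact Real.cos_periodic.sub_zsmul_eq _

/-- Pairwise fat-Gaussian bound: `pv(x)² ≤ (π²/2)(1 − cos x)`. [folklore] -/
theorem toIocMod_sq_le_pi_sq_div_two_mul_one_sub_cos (x : ℝ) :
    (toIocMod Real.two_pi_pos (-Real.pi) x) ^ 2 ≤ Real.pi ^ 2 / 2 * (1 - Real.cos x) := by
  have h1 := two_mul_sq_div_pi_sq_le_one_sub_cos (abs_toIocMod_two_pi_le x)
  rw [cos_toIocMod_two_pi] at h1
  have hπ : 0 < Real.pi ^ 2 := by positivity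
  rw [div_le_iff₀ hπ] at h1
  nlinarith

/-- **Stub S2 (fat-Gaussian domination of the modulus weight by coercivity (C)).**  If `c₀ ≥ 0`, `K ≥ 0` and
`c₀ ΣΣ (1 − cos(φ_w − φ_w')) ≤ Re F(φ)` for all `φ` (`F = genF c`), then for every `φ`
`‖exp(−K F(φ))‖ ≤ exp(−(2c₀K/π²) ΣΣ pv(φ_w − φ_w')²)`, `pv = toIocMod 2π (−π)`. [folklore] -/
theorem stub_fatGaussianDomination : ∀ (r : ℕ) (c₀ K : ℝ) (c : Table r), 0 ≤ c₀ → 0 ≤ K → (∀ φ : W r → ℝ, c₀ * ∑ w, ∑ w', (1 - Real.cos (φ w - φ w')) ≤ (genF c φ).re) → ∀ φ : W r → ℝ, ‖Complex.exp (-((K : ℂ) * genF c φ))‖ ≤ Real.exp (-(2 * c₀ * K / Real.pi ^ 2) * ∑ w, ∑ w', (toIocMod Real.two_pi_pos (-Real.pi) (φ w - φ w')) ^ 2) := by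
  intro r c₀ K c hc₀ hK hC φ
  rw [Complex.norm_exp, Real.exp_le_exp, Complex.neg_re, Complex.re_ofReal_mul]
  set S : ℝ := ∑ w, ∑ w', (toIocMod Real.two_pi_pos (-Real.pi) (φ w - φ w')) ^ 2 with hS
  set T : ℝ := ∑ w, ∑ w', (1 - Real.cos (φ w - φ w')) with hT
  have hJ : S ≤ Real.pi ^ 2 / 2 * T := by
    rw [hS, hT, Finset.mul_sum]
    refine Finset.sum_le_sum fun w _ => ?_
    rw [Finset.mul_sum]
    exact Finset.sum_le_sum fun w' _ => toIocMod_sq_le_pi_sq_div_two_mul_one_sub_cos (φ w - φ w')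
  have hcoef : 0 ≤ 2 * c₀ * K / Real.pi ^ 2 := by positivity
  have h3 : 2 * c₀ * K / Real.pi ^ 2 * S ≤ K * (genF c φ).re :=
    calc 2 * c₀ * K / Real.pi ^ 2 * S ≤ 2 * c₀ * K / Real.pi ^ 2 * (Real.pi ^ 2 / 2 * T) :=
          mul_le_mul_of_nonneg_left hJ hcoef
      _ = K * (c₀ * T) := by
          field_simp
      _ ≤ K * (genF c φ).re := mul_le_mul_of_nonneg_left (hC φ) hK
  linarith

end Summit.HubbardSuperconductivity.HubbardSuperconductivity.Theorems.FatGaussian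

end
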